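import Literature.MathematicalPhysics.KineticTheory.BoltzmannSolutions
import Literature.Analysis.FunctionSpaces.WeakCompactnessL1
import Mathlib.Analysis.Distribution.SchwartzSpace.Basic
import HarnessLib

/-!
# The DiPerna–Lions approximation scheme and weak stability theorem for the Boltzmann equation

Topic: MathematicalPhysics / KineticTheory. The decomposition of the DiPerna–Lions global
existence theorem (`Literature.MathematicalPhysics.KineticTheory.diperna_lions`, DiPerna–Lions, Ann. Math. 130 (1989) Thm p. 322)
into its two published halves, following the complete printed proof in
Cercignani–Illner–Pulvirenti 1994 §5.3 (after Gérard, Sém. Bourbaki 699) and Lions' Montecatini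
lectures (LNM 1551, 1993, §§II–III):

* **(A) the approximating scheme** (`Kinetic.diPernaLions_approximatingScheme`, named fact;
  CIP 1994 §5.3 Step 6, Lemma 5.3.6, and Step 7 with the a priori identities of Lemma 5.3.1 and
  the bounds (3.8)–(3.9), (3.21)–(3.23)): for a DiPerna–Lions kernel `B` and DiPerna–Lions data `f₀`
  there are truncated kernels `Bₙ → B`, normalisation parameters `δₙ ↘ 0`, Schwartz data
  `f₀ⁿ → f₀` and global smooth positive solutions `fⁿ` of the truncated, normalised equations
  `(∂ₜ + v·∇ₓ) fⁿ = (1 + δₙ ∫ fⁿ dv)⁻¹ Q_{Bₙ}(fⁿ, fⁿ)` obeying, uniformly in `n`, the mass–energy–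
  entropy bound and the entropy-dissipation bound;
* **(B) the weak stability / passage to the limit** (`Kinetic.diPernaLions_weakStability`, named
  fact; DiPerna–Lions 1989 (stability half of the main theorem); CIP 1994 §5.3 Steps 8–14;
  Lions 1993 Thm III.4 and Remark III.8 for sequences of renormalised solutions, with the entropy
  inequality (E) of DiPerna–Lions, Arch. Rational Mech. Anal. 114 (1991)): every such approximating
  sequence has a subsequence converging weakly in `L¹`, for every `t ≥ 0`, to a renormalised
  solution `f ∈ C([0,∞); L¹)` with `f(0) = f₀`, satisfying the mass–energy–entropy bound and the
  entropy inequality;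

and the **proved** assembly `Literature.MathematicalPhysics.KineticTheory.diperna_lions_of_approximatingScheme_of_weakStability`:
(A) and (B) imply `Literature.MathematicalPhysics.KineticTheory.diperna_lions`; conservation of mass for the limit is *derived*
there from conservation of mass of the approximate solutions, strong `L¹` convergence of the data
and weak `L¹` convergence of every time slice.

## Definitions

* `Kinetic.truncatedCollisionOp δ B g v = (1 + δ ∫ |g| dv)⁻¹ Q_B(g, g)(v)`: the normalised
  ("truncated") collision operator of the approximating equations (CIP 1994 (3.16); for `δ = 0` it
  is `Kinetic.collisionOpWith B g g`, `truncatedCollisionOp_zero`).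
* `Kinetic.entropyProductionIntegrand`, `Kinetic.eEntropyProduction`,
  `Kinetic.eTruncatedEntropyProduction`: the integrand of `Kinetic.entropyProduction`, its
  junk-free `ℝ≥0∞`-valued version `¼ ∫⁻ B (h'h'_* - h h_*) log (h'h'_*/(h h_*))`, and the normalised
  dissipation `(1 + δ ∫ |h|)⁻¹ e(h)` of CIP 1994 (3.24) (integrated over the velocity variable).
* `Kinetic.IsDiPernaLionsApproximateSolution δ B f`: `f` is a global classical solution of the
  truncated equation in the regularity class of CIP 1994 Lemma 5.3.1 / Lemma 5.3.6 (jointly `C¹` on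
  `[0,∞) × E × E`, positive, Schwartz in `(x, v)` with seminorms bounded on compact time
  intervals, `|log f|` of polynomial growth locally uniformly in `t`).
* `Kinetic.IsDiPernaLionsKernelApproximation B Bseq`: the approximating kernels of CIP 1994 Step 7
  (bounded, compactly supported in the relative velocity, DiPerna–Lions kernels obeying the growth
  condition (3.12) = DL (7) *uniformly in `n`*, converging to `B` in `L¹_loc` and a.e.).
* `Kinetic.IsDiPernaLionsDataApproximation f₀ f₀seq`: the approximating data of CIP 1994 Step 7
  (`f₀ⁿ → f₀` in `L¹`, with convergence of the weighted mass `∫ f₀ⁿ (1 + |x|² + |v|²)`, of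
  `∫ f₀ⁿ |log f₀ⁿ|` and of the entropy `H(f₀ⁿ)`).
* `Kinetic.UniformDiPernaLionsBounds δ Bseq fseq`: the entropy inequality (3.7) of each
  approximate solution and the uniform bounds (3.21)–(3.23) of CIP 1994 Step 7, the latter written
  with lower Lebesgue integrals (no Bochner junk values in hypotheses).

## Faithfulness notes

* CIP 1994 assume, besides DiPerna–Lions' (6)–(8), Gérard's simplifying hypothesis (3.13)
  `A ∈ L^∞_loc` (p. 143: "this last assumption was not made by DiPerna and Lions"); it is *not*
  assumed here, so (B) is DiPerna–Lions' theorem, of which CIP's Steps 8–14 are the printed proof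
  under (3.13).
* CIP's approximate solutions are `C¹(ℝ₊; 𝒮)` (Lemma 5.3.6); the class
  `IsDiPernaLionsApproximateSolution` records joint `C¹` regularity and Schwartz slices with
  seminorms bounded on compact time intervals (`L^∞_loc(ℝ₊; 𝒮) ∩ C¹`), which is what Lemma 5.3.1
  and Steps 8–14 use. The approximating kernels of Step 7 are moreover `C_c^∞`
  with a cut-off near grazing collisions; this is needed only inside the proof of Lemma 5.3.6
  (part of (A)) and is not recorded in `IsDiPernaLionsKernelApproximation`.
* CIP's Step 7 asks only `qₙ → q` a.e. (with (3.12)–(3.13) uniformly in `n`) of the approximating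
  kernels. `IsDiPernaLionsKernelApproximation` records in addition `Bₙ → B` in `L¹_loc(E × S^{d-1})`
  (field `tendsto_setLIntegral`): this is what the identification of the limits of `Aₙ ∗ fⁿ` and
  of the collision terms (CIP Lemma 5.3.11 (ii)–(iii)) uses, it holds for the truncation–
  mollification approximations of Step 7 (dominated convergence), and without it a.e. convergence
  plus uniform bounds would allow the `qₙ` to concentrate extra mass on null sets, changing the
  limit equation. It is an addition to the printed text of Step 7, making (A) formally stronger and
  (B) formally weaker than a literal reading.
* The entropy inequality with the dissipation term for the limit (conjunct
  `Kinetic.HasEntropyInequality` of `diperna_lions`) is DiPerna–Lions 1991 / Lions 1993 Thm III.4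
  (E) ("with `∫∫ f(0) log f(0)` replaced by `limₙ ∫∫ fⁿ(0) log fⁿ(0)`"); CIP prove the weaker bound
  (3.9). Convergence of the initial entropies is therefore part of the data approximation.
* `f(0) = f₀` holds pointwise: `f` is only determined a.e., `f(0)` is the weak `L¹` limit of
  `fⁿ(0)` (Lions 1993 Remark III.8), which converges strongly to `f₀`, and redefining `f(0, ·)` on a
  null set does not affect `Kinetic.IsRenormalisedSolution`.
* Positions and velocities range over a finite-dimensional real inner product space `E` (the
  setting of `Kinetic.IsRenormalisedSolution` and of `Hilbert6.diperna_lions`); the sources have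
  `ℝ^N`.

## References

* R. J. DiPerna, P.-L. Lions, *On the Cauchy problem for Boltzmann equations: global existence and
  weak stability*, Ann. of Math. 130 (1989) 321–366 (Theorem p. 322; Definition p. 326).
* R. J. DiPerna, P.-L. Lions, *Global solutions of Boltzmann's equation and the entropy
  inequality*, Arch. Rational Mech. Anal. 114 (1991) 47–55.
* C. Cercignani, R. Illner, M. Pulvirenti, *The Mathematical Theory of Dilute Gases*, Springer
  (1994), §5.3: Lemma 5.3.1 (p. 141), (3.12)–(3.13) (p. 143), Thm 5.3.5 (p. 144), (3.16) and
  Lemma 5.3.6 (p. 145), Step 7 (3.21)–(3.24) (p. 147), Steps 8–14 (pp. 147–160).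
* P.-L. Lions, *Global solutions of kinetic models and related problems*, in: Nonequilibrium
  Problems in Many-Particle Systems, LNM 1551 (1993) 58–86: (21)–(23), Thm III.1, Rem. III.1,
  Thm III.4, Rem. III.8.
-/

open MeasureTheory Metric Real Set Filter Topology
open scoped InnerProductSpace ENNReal

noncomputable section

namespace Literature.MathematicalPhysics.KineticTheory

variable {E : Type*} [NormedAddCommGroup E] [InnerProductSpace ℝ E] [FiniteDimensional ℝ E]
  [MeasurableSpace E] [BorelSpace E]

/-! ## The truncated, normalised collision operator and entropy production -/

/-- The normalised ("truncated") collision operator of the DiPerna–Lions approximating equations,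
`Q̃_δ(g, g)(v) = (1 + δ ∫ |g| dv)⁻¹ Q_B(g, g)(v)` (CIP 1994 §5.3 (3.16); the truncation of the
kernel itself is carried by `B`). Bochner integrals, junk value `0`. [cite: CIPDiluteGases1994, §5.3 (3.16)] -/
def truncatedCollisionOp (δ : ℝ) (B : E × E → sphere (0 : E) 1 → ℝ) (g : E → ℝ) (v : E) : ℝ :=
  (1 + δ * ∫ w, |g w|)⁻¹ * Literature.Analysis.FluidPDE.collisionOpWith B g g v

/-- For `δ = 0` the normalised operator is the collision operator `Q_B(g, g)`. [folklore] -/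
@[simp]
theorem truncatedCollisionOp_zero (B : E × E → sphere (0 : E) 1 → ℝ) (g : E → ℝ) :
    truncatedCollisionOp 0 B g = Literature.Analysis.FluidPDE.collisionOpWith B g g := by
  funext v
  simp [truncatedCollisionOp]

/-- The integrand `B (h'h'_* - h h_*) log (h'h'_* / (h h_*))` of the entropy production functional
`Kinetic.entropyProduction` at `q = ((v, v_*), ω)` (DiPerna–Lions 1989 p. 323 (10); CIP 1994
(3.7)). [cite: CIPDiluteGases1994, §5.3 (3.7)] -/
def entropyProductionIntegrand (B : E × E → sphere (0 : E) 1 → ℝ) (h : E → ℝ)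
    (q : (E × E) × sphere (0 : E) 1) : ℝ :=
  B q.1 q.2 *
    ((h (KineticTheory.collide q.2 q.1).1 * h (KineticTheory.collide q.2 q.1).2 - h q.1.1 * h q.1.2) *
      log (h (KineticTheory.collide q.2 q.1).1 * h (KineticTheory.collide q.2 q.1).2 / (h q.1.1 * h q.1.2)))

/-- `Kinetic.entropyProduction` is `¼ ∫` of `entropyProductionIntegrand`. [folklore] -/
theorem entropyProduction_eq_integral (B : E × E → sphere (0 : E) 1 → ℝ) (h : E → ℝ) :
    Literature.Analysis.FluidPDE.entropyProduction B h =
      4⁻¹ * ∫ q, entropyProductionIntegrand B h q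
        ∂((volume.prod volume).prod KineticTheory.sphereMeasure) :=
  rfl

omit [FiniteDimensional ℝ E] [MeasurableSpace E] [BorelSpace E] in
/-- The integrand of the entropy production is pointwise nonnegative for `B ≥ 0` and `h > 0`
(Boltzmann's inequality `(a - b) log (a/b) ≥ 0`; CIP 1994 §3.2). [cite: CIPDiluteGases1994, §3.2] -/
theorem entropyProductionIntegrand_nonneg {B : E × E → sphere (0 : E) 1 → ℝ}
    (hB : ∀ p ω, 0 ≤ B p ω) {h : E → ℝ} (hpos : ∀ v, 0 < h v)
    (q : (E × E) × sphere (0 : E) 1) : 0 ≤ entropyProductionIntegrand B h q := by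
  unfold entropyProductionIntegrand
  refine mul_nonneg (hB _ _) ?_
  set a := h (KineticTheory.collide q.2 q.1).1 * h (KineticTheory.collide q.2 q.1).2
  set b := h q.1.1 * h q.1.2
  have ha : 0 < a := mul_pos (hpos _) (hpos _)
  have hb : 0 < b := mul_pos (hpos _) (hpos _)
  rcases le_total b a with hab | hab
  · exact mul_nonneg (sub_nonneg.2 hab) (log_nonneg ((one_le_div hb).2 hab))
  · exact mul_nonneg_of_nonpos_of_nonpos (sub_nonpos.2 hab)
      (log_nonpos (div_pos ha hb).le ((div_le_one hb).2 hab))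

/-- The junk-free, `ℝ≥0∞`-valued entropy production
`e_B(h) = ¼ ∫⁻ [B (h'h'_* - h h_*) log (h'h'_*/(h h_*))]₊ ∈ [0, ∞]` of a velocity density `h`
(DiPerna–Lions 1989 (10); CIP 1994 (3.7); Lions 1993 (17), (23)). It agrees with
`ENNReal.ofReal (Kinetic.entropyProduction B h)` when the integrand is integrable and `h > 0`
(`eEntropyProduction_eq_ofReal`). [cite: CIPDiluteGases1994, §5.3 (3.7)] -/
def eEntropyProduction (B : E × E → sphere (0 : E) 1 → ℝ) (h : E → ℝ) : ℝ≥0∞ :=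
  ∫⁻ q, ENNReal.ofReal (4⁻¹ * entropyProductionIntegrand B h q)
    ∂((volume.prod volume).prod KineticTheory.sphereMeasure)

/-- For `B ≥ 0`, `h > 0` and an integrable entropy-production integrand, the `ℝ≥0∞`-valued entropy
production is the real one. [folklore] -/
theorem eEntropyProduction_eq_ofReal {B : E × E → sphere (0 : E) 1 → ℝ} (hB : ∀ p ω, 0 ≤ B p ω)
    {h : E → ℝ} (hpos : ∀ v, 0 < h v)
    (hint : Integrable (entropyProductionIntegrand B h)
      ((volume.prod volume).prod KineticTheory.sphereMeasure)) :
    eEntropyProduction B h = ENNReal.ofReal (Literature.Analysis.FluidPDE.entropyProduction B h) := by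
  rw [entropyProduction_eq_integral, ← integral_const_mul, eEntropyProduction,
    ofReal_integral_eq_lintegral_ofReal (hint.const_mul _)
      (Eventually.of_forall fun q => mul_nonneg (by norm_num)
        (entropyProductionIntegrand_nonneg hB hpos q))]

/-- The normalised entropy dissipation of the approximating equations, integrated over the
velocity variable: `(1 + δ ∫ |h| dv)⁻¹ e_{B}(h)` (CIP 1994 §5.3 (3.24), `∫ eₙ(fⁿ) dξ`), valued in
`ℝ≥0∞`. [cite: CIPDiluteGases1994, §5.3 (3.24)] -/
def eTruncatedEntropyProduction (δ : ℝ) (B : E × E → sphere (0 : E) 1 → ℝ) (h : E → ℝ) : ℝ≥0∞ :=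
  ENNReal.ofReal ((1 + δ * ∫ w, |h w|)⁻¹) * eEntropyProduction B h

/-- For `δ = 0` the normalised dissipation is `eEntropyProduction`. [folklore] -/
@[simp]
theorem eTruncatedEntropyProduction_zero (B : E × E → sphere (0 : E) 1 → ℝ) (h : E → ℝ) :
    eTruncatedEntropyProduction 0 B h = eEntropyProduction B h := by
  simp [eTruncatedEntropyProduction]

/-! ## Approximate solutions, approximating kernels and data, uniform bounds -/

/-- *Approximate solutions of the DiPerna–Lions scheme*: `f` is a global classical solution of the
truncated, normalised Boltzmann equation
`(∂ₜ + v·∇ₓ) f = (1 + δ ∫ |f| dv)⁻¹ Q_B(f, f)` on `[0, ∞) × E × E` in the regularity class of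
CIP 1994 Lemma 5.3.1 / Lemma 5.3.6 (`f ∈ C¹(ℝ₊; 𝒮(ℝ^d × ℝ^d))` positive with `|ln f|` of
polynomial growth uniformly on compact time intervals), recorded as: jointly `C¹` on
`[0,∞) × E × E` (time derivative taken within `[0, ∞)`), positive, each slice `f(t)` smooth with
every Schwartz seminorm `sup_{(x,v)} |(x,v)|^k |D^n f(t)|` bounded on compact time intervals (so
`f(t) ∈ 𝒮(E × E)` locally uniformly in `t`), and `|log f|` growing at most polynomially in
`(x, v)` locally uniformly in `t`. [cite: CIPDiluteGases1994, §5.3 Lemma 5.3.6] -/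
structure IsDiPernaLionsApproximateSolution (δ : ℝ) (B : E × E → sphere (0 : E) 1 → ℝ)
    (f : ℝ → E → E → ℝ) : Prop where
  /-- `f ∈ C¹([0, ∞) × E × E)`. -/
  contDiffOn : ContDiffOn ℝ 1 (fun z : ℝ × E × E => f z.1 z.2.1 z.2.2) (Ici 0 ×ˢ univ)
  /-- `f > 0` on `[0, ∞) × E × E`. -/
  pos : ∀ t ≥ (0 : ℝ), ∀ x v, 0 < f t x v
  /-- Each slice `f(t)`, `t ≥ 0`, is smooth on `E × E`. -/
  contDiff_slice : ∀ t ≥ (0 : ℝ), ContDiff ℝ ((⊤ : ℕ∞) : WithTop ℕ∞) (fun z : E × E => f t z.1 z.2)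
  /-- The Schwartz seminorms of the slices are bounded on compact time intervals:
  `sup_{t ∈ [0,T]} sup_z |z|^k |D^n f(t)(z)| < ∞` for all `k, n`. -/
  decay_slice : ∀ T ≥ (0 : ℝ), ∀ k n : ℕ, ∃ C : ℝ, ∀ t ∈ Icc 0 T, ∀ z : E × E,
    ‖z‖ ^ k * ‖iteratedFDeriv ℝ n (fun z : E × E => f t z.1 z.2) z‖ ≤ C
  /-- `|log f|` grows at most polynomially in `(x, v)`, uniformly on compact time intervals. -/
  abs_log_le : ∀ T ≥ (0 : ℝ), ∃ C : ℝ, ∃ k : ℕ, ∀ t ∈ Icc 0 T, ∀ x v,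
    |log (f t x v)| ≤ C * (1 + ‖x‖ + ‖v‖) ^ k
  /-- The truncated equation `∂ₜ f + v·∇ₓ f = Q̃_δ(f, f)` pointwise on `[0, ∞) × E × E`. -/
  eqn : ∀ t ≥ (0 : ℝ), ∀ x v,
    derivWithin (fun s => f s x v) (Ici 0) t + fderiv ℝ (fun y => f t y v) x v =
      truncatedCollisionOp δ B (f t x) v

/-- Approximate solutions are nonnegative. [folklore] -/
theorem IsDiPernaLionsApproximateSolution.nonneg {δ : ℝ} {B : E × E → sphere (0 : E) 1 → ℝ}
    {f : ℝ → E → E → ℝ} (hf : IsDiPernaLionsApproximateSolution δ B f) (t : ℝ) (ht : 0 ≤ t)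
    (x v : E) : 0 ≤ f t x v :=
  (hf.pos t ht x v).le

/-- The slice `f(t)`, `t ≥ 0`, of an approximate solution, as a Schwartz function on `E × E`.
[folklore] -/
def IsDiPernaLionsApproximateSolution.sliceSchwartz {δ : ℝ}
    {B : E × E → sphere (0 : E) 1 → ℝ} {f : ℝ → E → E → ℝ}
    (hf : IsDiPernaLionsApproximateSolution δ B f) (t : ℝ) (ht : 0 ≤ t) :
    SchwartzMap (E × E) ℝ where
  toFun z := f t z.1 z.2
  smooth' := hf.contDiff_slice t ht
  decay' k n := by
    obtain ⟨C, hC⟩ := hf.decay_slice t ht k n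
    exact ⟨C, fun z => hC t ⟨ht, le_rfl⟩ z⟩

/-- Unfolding of `sliceSchwartz`. [folklore] -/
@[simp]
theorem IsDiPernaLionsApproximateSolution.sliceSchwartz_apply {δ : ℝ}
    {B : E × E → sphere (0 : E) 1 → ℝ} {f : ℝ → E → E → ℝ}
    (hf : IsDiPernaLionsApproximateSolution δ B f) (t : ℝ) (ht : 0 ≤ t) (z : E × E) :
    hf.sliceSchwartz t ht z = f t z.1 z.2 :=
  rfl

/-- Each slice `f(t)`, `t ≥ 0`, of an approximate solution is integrable on `E × E` (Schwartz
functions are integrable for Lebesgue measure). [folklore] -/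
theorem IsDiPernaLionsApproximateSolution.integrable_slice {δ : ℝ}
    {B : E × E → sphere (0 : E) 1 → ℝ} {f : ℝ → E → E → ℝ}
    (hf : IsDiPernaLionsApproximateSolution δ B f) (t : ℝ) (ht : 0 ≤ t) :
    Integrable (fun z : E × E => f t z.1 z.2) (volume.prod volume) :=
  (hf.sliceSchwartz t ht).integrable

/-- *Approximating kernels* (CIP 1994 §5.3 Step 7; DiPerna–Lions 1989): a sequence of bounded
DiPerna–Lions kernels `Bₙ` (`Hilbert6.IsDiPernaLionsKernel`: measurable, `≥ 0`, Galilean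
invariant, micro-reversible, `L¹_loc`, growth condition (7)), compactly supported in the relative
velocity, satisfying the growth condition (3.12) = DL (7) *uniformly in `n`*, and converging to `B`
in `L¹_loc(E × S)` and a.e. in the variables `(z, ω) = (v - v_*, ω)`. (CIP take `qₙ ∈ C_c^∞`
vanishing near grazing collisions, a regularity used only to solve the truncated problems.) [cite: CIPDiluteGases1994, §5.3 Step 7] -/
structure IsDiPernaLionsKernelApproximation (B : E × E → sphere (0 : E) 1 → ℝ)
    (Bseq : ℕ → E × E → sphere (0 : E) 1 → ℝ) : Prop where
  /-- Each `Bₙ` is a DiPerna–Lions kernel. -/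
  isDiPernaLionsKernel : ∀ n, KineticTheory.IsDiPernaLionsKernel (Bseq n)
  /-- Each `Bₙ` is bounded. -/
  bounded : ∀ n, ∃ C : ℝ, ∀ p ω, Bseq n p ω ≤ C
  /-- Each `Bₙ(z, ω)` vanishes for large relative velocities `z`. -/
  eq_zero_of_le : ∀ n, ∃ R : ℝ, ∀ (z : E) ω, R ≤ ‖z‖ → Bseq n (z, 0) ω = 0
  /-- The growth condition (3.12) holds uniformly in `n`: for every `R` and `ε > 0` there is `ρ`
  with `(1 + |v|²)⁻¹ ∫_{|z - v| ≤ R} Aₙ(z) dz ≤ ε` for all `n` and all `|v| ≥ ρ`. -/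
  uniform_growth : ∀ R ε : ℝ, 0 < ε → ∃ ρ : ℝ, ∀ n, ∀ v : E, ρ ≤ ‖v‖ →
    (1 + ‖v‖ ^ 2)⁻¹ * ∫ z in closedBall v R, KineticTheory.kernelAngularIntegral (Bseq n) z ≤ ε
  /-- `Bₙ → B` in `L¹_loc(E × S^{d-1})` in the variables `(z, ω)`. -/
  tendsto_setLIntegral : ∀ R : ℝ, Tendsto (fun n => ∫⁻ q in closedBall (0 : E) R ×ˢ univ,
      ‖Bseq n (q.1, 0) q.2 - B (q.1, 0) q.2‖ₑ ∂(volume.prod KineticTheory.sphereMeasure)) atTop (𝓝 0)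
  /-- `Bₙ → B` almost everywhere in `(z, ω)`. -/
  tendsto_ae : ∀ᵐ q : E × sphere (0 : E) 1 ∂(volume.prod KineticTheory.sphereMeasure),
    Tendsto (fun n => Bseq n (q.1, 0) q.2) atTop (𝓝 (B (q.1, 0) q.2))

/-- *Approximating data* (CIP 1994 §5.3 Step 7, first two displays p. 147; Lions 1993 Thm III.4,
"(E) with `∫∫ f(0) log f(0)` replaced by `limₙ ∫∫ fⁿ(0) log fⁿ(0)`"): `f₀ⁿ → f₀` in `L¹(E × E)`,
with convergence of the weighted masses `∫∫ f₀ⁿ (1 + |x|² + |v|²) → ∫∫ f₀ (1 + |x|² + |v|²)`, of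
`∫∫ f₀ⁿ |log f₀ⁿ| → ∫∫ f₀ |log f₀|`, and of the entropies `H(f₀ⁿ) → H(f₀)`
(`Kinetic.boltzmannEntropy`). Lower Lebesgue integrals: no junk values. [cite: CIPDiluteGases1994, §5.3 Step 7] -/
structure IsDiPernaLionsDataApproximation (f₀ : E → E → ℝ) (f₀seq : ℕ → E → E → ℝ) : Prop where
  /-- `f₀ⁿ → f₀` in `L¹(E × E)`. -/
  tendsto_lintegral_sub : Tendsto (fun n => ∫⁻ z : E × E, ‖f₀seq n z.1 z.2 - f₀ z.1 z.2‖ₑ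
    ∂(volume.prod volume)) atTop (𝓝 0)
  /-- `∫∫ f₀ⁿ (1 + |x|² + |v|²) → ∫∫ f₀ (1 + |x|² + |v|²)`. -/
  tendsto_moments : Tendsto (fun n => ∫⁻ z : E × E,
      ENNReal.ofReal (f₀seq n z.1 z.2 * (1 + ‖z.1‖ ^ 2 + ‖z.2‖ ^ 2)) ∂(volume.prod volume)) atTop
    (𝓝 (∫⁻ z : E × E, ENNReal.ofReal (f₀ z.1 z.2 * (1 + ‖z.1‖ ^ 2 + ‖z.2‖ ^ 2))
      ∂(volume.prod volume)))
  /-- `∫∫ f₀ⁿ |log f₀ⁿ| → ∫∫ f₀ |log f₀|`. -/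
  tendsto_absEntropy : Tendsto (fun n => ∫⁻ z : E × E,
      ENNReal.ofReal (f₀seq n z.1 z.2 * |log (f₀seq n z.1 z.2)|) ∂(volume.prod volume)) atTop
    (𝓝 (∫⁻ z : E × E, ENNReal.ofReal (f₀ z.1 z.2 * |log (f₀ z.1 z.2)|) ∂(volume.prod volume)))
  /-- `H(f₀ⁿ) → H(f₀)`. -/
  tendsto_boltzmannEntropy :
    Tendsto (fun n => Literature.Analysis.FluidPDE.boltzmannEntropy (f₀seq n)) atTop (𝓝 (Literature.Analysis.FluidPDE.boltzmannEntropy f₀))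

/-- *A priori entropy inequality and uniform bounds* of the approximating sequence (CIP 1994 §5.3
Lemma 5.3.1 (3.7) and Step 7 (3.21)–(3.23), consequences of (3.8)–(3.9); Lions 1993 (17),
(22)–(23)): each `fⁿ` obeys the entropy inequality of the truncated equation,
`H(fⁿ(t)) + ∫₀ᵗ ∫∫ eₙ(fⁿ) dx dv ds ≤ H(fⁿ(0))` ((3.7), an identity for the smooth solutions), and,
for every `T`, `sup_n sup_{t ∈ [0,T]} ∫∫ fⁿ(t) (1 + |x|² + |v|² + |log fⁿ(t)|) dx dv < ∞` and
`sup_n ∫₀^∞ ∫∫ eₙ(fⁿ) dx dv dt < ∞` for the normalised dissipation (3.24). Lower Lebesgue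
integrals in the bounds: no junk values. [cite: CIPDiluteGases1994, §5.3 (3.7) and Step 7 (3.21)–(3.23)] -/
structure UniformDiPernaLionsBounds (δ : ℕ → ℝ) (Bseq : ℕ → E × E → sphere (0 : E) 1 → ℝ)
    (fseq : ℕ → ℝ → E → E → ℝ) : Prop where
  /-- (3.7): the entropy inequality of the truncated equation for each `fⁿ`,
  `H(fⁿ(t)) + ∫₀ᵗ ∫∫ eₙ(fⁿ) ≤ H(fⁿ(0))`. -/
  entropy_le : ∀ n, ∀ t ≥ (0 : ℝ), Literature.Analysis.FluidPDE.boltzmannEntropy (fseq n t) +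
    (∫⁻ p : ℝ × E in Ioc 0 t ×ˢ univ, eTruncatedEntropyProduction (δ n) (Bseq n) (fseq n p.1 p.2)
      ∂(volume.prod volume)).toReal ≤ Literature.Analysis.FluidPDE.boltzmannEntropy (fseq n 0)
  /-- (3.21)–(3.22): uniform mass, second moment and entropy bound on compact time intervals. -/
  massEntropy_le : ∀ T ≥ (0 : ℝ), ∃ C : ℝ, ∀ n, ∀ t ∈ Icc 0 T,
    ∫⁻ z : E × E, ENNReal.ofReal (fseq n t z.1 z.2 *
      (1 + ‖z.1‖ ^ 2 + ‖z.2‖ ^ 2 + |log (fseq n t z.1 z.2)|)) ∂(volume.prod volume)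
        ≤ ENNReal.ofReal C
  /-- (3.23): uniform bound on the total normalised entropy dissipation over `(0, ∞) × E`. -/
  dissipation_le : ∃ C : ℝ, ∀ n,
    ∫⁻ p : ℝ × E in Ioi 0 ×ˢ univ, eTruncatedEntropyProduction (δ n) (Bseq n) (fseq n p.1 p.2)
      ∂(volume.prod volume) ≤ ENNReal.ofReal C

/-! ## (A) The approximating scheme (named fact) -/

/-- **The DiPerna–Lions approximating scheme** (CIP 1994 §5.3 Step 6, Lemma 5.3.6 (p. 145) and
Step 7 (p. 146–147), with Lemma 5.3.1 (3.4), (3.8), (3.9); DiPerna–Lions 1989). Let `B` satisfy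
the DiPerna–Lions assumptions (6)–(8) and let `f₀ ≥ 0` with
`∫∫ f₀ (1 + |x|² + |v|² + |log f₀|) < ∞`. Then there exist normalisation parameters `δₙ ↘ 0`
(`δₙ > 0`), approximating kernels `Bₙ → B` (`IsDiPernaLionsKernelApproximation`), and global
approximate solutions `fⁿ` of `(∂ₜ + v·∇ₓ) fⁿ = (1 + δₙ ∫ fⁿ dv)⁻¹ Q_{Bₙ}(fⁿ, fⁿ)` in the class of
Lemma 5.3.6 (`IsDiPernaLionsApproximateSolution`) whose data `fⁿ(0)` approximate `f₀`
(`IsDiPernaLionsDataApproximation`), which conserve mass ((3.4):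
`∫∫ fⁿ(t) = ∫∫ fⁿ(0)`, `Kinetic.totalMass`), obey the entropy identity (3.7) (recorded as an
inequality) and satisfy the uniform bounds (3.21)–(3.23) (`UniformDiPernaLionsBounds`). [cite: DiPernaLionsAnnals1989, Theorem p. 322 (existence part)]
[cite: CIPDiluteGases1994, §5.3 Lemma 5.3.6 (p. 145) and Step 7 (3.21)–(3.23) (p. 147)] -/
def diPernaLions_approximatingScheme : Prop :=
  ∀ {E : Type*} [NormedAddCommGroup E] [InnerProductSpace ℝ E] [FiniteDimensional ℝ E]
    [MeasurableSpace E] [BorelSpace E] {B : E × E → sphere (0 : E) 1 → ℝ},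
    KineticTheory.IsDiPernaLionsKernel B → ∀ {f₀ : E → E → ℝ}, Literature.Analysis.FluidPDE.HasDiPernaLionsData f₀ →
      ∃ (δ : ℕ → ℝ) (Bseq : ℕ → E × E → sphere (0 : E) 1 → ℝ) (fseq : ℕ → ℝ → E → E → ℝ),
        (∀ n, 0 < δ n) ∧ Antitone δ ∧ Tendsto δ atTop (𝓝 0) ∧
        IsDiPernaLionsKernelApproximation B Bseq ∧
        IsDiPernaLionsDataApproximation f₀ (fun n => fseq n 0) ∧
        (∀ n, IsDiPernaLionsApproximateSolution (δ n) (Bseq n) (fseq n)) ∧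
        (∀ n, ∀ t ≥ (0 : ℝ), Literature.Analysis.FluidPDE.totalMass (fseq n t) = Literature.Analysis.FluidPDE.totalMass (fseq n 0)) ∧
        UniformDiPernaLionsBounds δ Bseq fseq

/-! ## (B) Weak stability and passage to the limit (named fact) -/

/-- **DiPerna–Lions weak stability / passage to the limit** (DiPerna–Lions 1989, the stability
half of the main theorem p. 322; printed proof: CIP 1994 §5.3 Steps 8–14, pp. 147–160 — Lemma
5.3.7 (weak compactness of `Q±ₙ(fⁿ,fⁿ)/(1+fⁿ)`), Step 10 (extraction, (3.30)–(3.32),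
`f ∈ C([0,∞); L¹)`), Lemmas 5.3.8–5.3.11 (velocity averaging), Lemma 5.3.12 and Step 14 (the limit
is a mild and renormalised solution, entropy bound); for sequences of renormalised solutions and
with the entropy inequality (E): Lions 1993 Thm III.4 and Remark III.8, DiPerna–Lions 1991).
Let `B` satisfy (6)–(8), `f₀` be DiPerna–Lions data, `δₙ ↘ 0`, `Bₙ → B` approximating kernels with
(3.12) uniformly in `n`, and let `fⁿ` be approximate solutions of the truncated, normalised
equations whose data approximate `f₀` and which obey the entropy inequality (3.7) and the uniform
bounds (3.21)–(3.23). Then a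
subsequence `f^{φ(k)}` converges, weakly in `L¹(E × E)` for every `t ≥ 0` (`Literature.Analysis.FunctionSpaces.TendstoWeaklyL1`),
to a renormalised solution `f` of the Boltzmann equation with kernel `B`
(`Kinetic.IsRenormalisedSolution`: `f ∈ C([0,∞); L¹)`, `Q±(f,f)/(1+f) ∈ L¹_loc`, the renormalised
equation in `𝒟'`) with `f(0) = f₀`, satisfying
`sup_{[0,T]} ∫∫ f (1 + |x|² + |v|² + |log f|) < ∞` for every `T` and the entropy inequality
`H(f(t)) + ∫₀ᵗ ∫ D(f) ≤ H(f₀)` (`Kinetic.HasEntropyInequality`). CIP's printed proof assumes in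
addition Gérard's (3.13) `A ∈ L^∞_loc`, not assumed by DiPerna–Lions nor here. The weak convergence of
the slices is `Literature.Analysis.FunctionSpaces.TendstoWeaklyL1` (`∫∫ f^{φ(k)}(t) ψ → ∫∫ f(t) ψ` for every bounded measurable
`ψ`). [cite: DiPernaLionsAnnals1989, Theorem p. 322 (stability part)]
[cite: CIPDiluteGases1994, §5.3 Steps 8–14 (pp. 147–160)] [cite: Lions1993Kinetic, Thm III.4 and Rem. III.8] -/
def diPernaLions_weakStability : Prop :=
  ∀ {E : Type*} [NormedAddCommGroup E] [InnerProductSpace ℝ E] [FiniteDimensional ℝ E]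
    [MeasurableSpace E] [BorelSpace E] {B : E × E → sphere (0 : E) 1 → ℝ},
    KineticTheory.IsDiPernaLionsKernel B → ∀ {f₀ : E → E → ℝ}, Literature.Analysis.FluidPDE.HasDiPernaLionsData f₀ →
    ∀ {δ : ℕ → ℝ} {Bseq : ℕ → E × E → sphere (0 : E) 1 → ℝ} {fseq : ℕ → ℝ → E → E → ℝ},
      (∀ n, 0 < δ n) → Antitone δ → Tendsto δ atTop (𝓝 0) →
      IsDiPernaLionsKernelApproximation B Bseq →
      IsDiPernaLionsDataApproximation f₀ (fun n => fseq n 0) →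
      (∀ n, IsDiPernaLionsApproximateSolution (δ n) (Bseq n) (fseq n)) →
      UniformDiPernaLionsBounds δ Bseq fseq →
        ∃ φ : ℕ → ℕ, StrictMono φ ∧ ∃ f : ℝ → E → E → ℝ,
          Literature.Analysis.FluidPDE.IsRenormalisedSolution B f ∧ f 0 = f₀ ∧
          (∀ T ≥ (0 : ℝ), ∃ C : ℝ, ∀ t ∈ Icc 0 T,
            ∫⁻ z : E × E, ENNReal.ofReal (f t z.1 z.2 *
              (1 + ‖z.1‖ ^ 2 + ‖z.2‖ ^ 2 + |log (f t z.1 z.2)|)) ∂(volume.prod volume)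
                ≤ ENNReal.ofReal C) ∧
          Literature.Analysis.FluidPDE.HasEntropyInequality B f ∧
          (∀ t ≥ (0 : ℝ), Literature.Analysis.FunctionSpaces.TendstoWeaklyL1 (fun k (z : E × E) => fseq (φ k) t z.1 z.2)
            (fun z => f t z.1 z.2) (volume.prod volume))

end Literature.MathematicalPhysics.KineticTheory

/-! ## Assembly: (A) and (B) imply the DiPerna–Lions theorem -/

namespace Literature.MathematicalPhysics.KineticTheory

universe u

variable {E : Type u} [NormedAddCommGroup E] [InnerProductSpace ℝ E] [FiniteDimensional ℝ E]
  [MeasurableSpace E] [BorelSpace E]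

/-- The total mass `∫_x ∫_v g` of a density which is integrable on `E × E` is its integral for the
product measure (Fubini). [folklore] -/
theorem totalMass_eq_integral_prod {g : E → E → ℝ}
    (hg : Integrable (fun z : E × E => g z.1 z.2) (volume.prod volume)) :
    Literature.Analysis.FluidPDE.totalMass g = ∫ z : E × E, g z.1 z.2 ∂(volume.prod volume) := by
  rw [Literature.Analysis.FluidPDE.totalMass, integral_prod _ hg]

/-- A time slice `f(t)`, `t ≥ 0`, of a renormalised solution is integrable on `E × E`
(measurable with `∫∫ f(t) (1 + |x|² + |v|²) < ∞` and `f ≥ 0`). [folklore] -/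
theorem integrable_slice_of_isRenormalisedSolution {B : E × E → sphere (0 : E) 1 → ℝ}
    {f : ℝ → E → E → ℝ} (hf : Literature.Analysis.FluidPDE.IsRenormalisedSolution B f) (t : ℝ) (ht : 0 ≤ t) :
    Integrable (fun z : E × E => f t z.1 z.2) (volume.prod volume) := by
  obtain ⟨C, hC⟩ := hf.massEnergy_le t ht
  have hbound := hC t ⟨ht, le_rfl⟩
  refine ⟨hf.aestronglyMeasurable_slice t ht, ?_⟩
  refine lt_of_le_of_lt (lintegral_mono fun z => ?_) (hbound.trans_lt ENNReal.ofReal_lt_top)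
  have h0 : 0 ≤ f t z.1 z.2 := hf.nonneg t ht z.1 z.2
  rw [Real.enorm_eq_ofReal h0]
  refine ENNReal.ofReal_le_ofReal ?_
  have hw : (1 : ℝ) ≤ 1 + ‖z.1‖ ^ 2 + ‖z.2‖ ^ 2 := by nlinarith [sq_nonneg ‖z.1‖, sq_nonneg ‖z.2‖]
  nlinarith

/-- **Assembly of the DiPerna–Lions theorem from its two published halves**: the approximating
scheme (A) (`Kinetic.diPernaLions_approximatingScheme`, CIP 1994 Lemma 5.3.6 + Step 7) and the weak
stability theorem (B) (`Kinetic.diPernaLions_weakStability`, DiPerna–Lions 1989; CIP 1994 Steps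
8–14; Lions 1993 Thm III.4) imply **hilbert6.S11** `Hilbert6.diperna_lions`. The renormalised
solution, `f(0) = f₀`, the mass–moment–entropy bound and the entropy inequality come from (B);
conservation of mass `∫∫ f(t) = ∫∫ f₀` is derived: `∫∫ fⁿ(t) = ∫∫ fⁿ(0)` by (A), `∫∫ fⁿ(0) → ∫∫ f₀`
by strong `L¹` convergence of the data, and `∫∫ f^{φ(k)}(t) → ∫∫ f(t)` by weak `L¹` convergence of
the slices (test function `1`), the iterated integrals `Kinetic.totalMass` being product integrals
by Fubini. [cite: CIPDiluteGases1994, §5.3 Thm 5.3.5 (p. 144; proof = Steps 6–14)]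
[cite: DiPernaLionsAnnals1989, Theorem p. 322] -/
theorem diperna_lions_of_approximatingScheme_of_weakStability
    (hScheme : KineticTheory.diPernaLions_approximatingScheme.{u})
    (hStab : KineticTheory.diPernaLions_weakStability.{u}) : diperna_lions (E := E) := by
  intro B hB f₀ hf₀
  obtain ⟨δ, Bseq, fseq, hδpos, hδanti, hδlim, hker, hdata, hsol, hmass, hbounds⟩ :=
    hScheme hB hf₀
  obtain ⟨φ, hφ, f, hren, hf0, hbound, hent, hweak⟩ :=
    hStab hB hf₀ hδpos hδanti hδlim hker hdata hsol hbounds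
  refine ⟨f, hren, hf0, hbound, fun t ht => ?_, hent⟩
  -- integrability of the slices involved
  have hft : Integrable (fun z : E × E => f t z.1 z.2) (volume.prod volume) :=
    integrable_slice_of_isRenormalisedSolution hren t ht
  have hf0i : Integrable (fun z : E × E => f₀ z.1 z.2) (volume.prod volume) := by
    have := integrable_slice_of_isRenormalisedSolution hren 0 le_rfl
    simpa [hf0] using this
  have hfn : ∀ n, ∀ s ≥ (0 : ℝ), Integrable (fun z : E × E => fseq n s z.1 z.2)
      (volume.prod volume) := fun n s hs => (hsol n).integrable_slice s hs
  -- (1) `∫∫ f^{φ k}(t) → ∫∫ f(t)` by weak convergence tested against `1`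
  have h1 : Tendsto (fun k => Literature.Analysis.FluidPDE.totalMass (fseq (φ k) t)) atTop
      (𝓝 (Literature.Analysis.FluidPDE.totalMass (f t))) := by
    have key := hweak t ht (fun _ => (1 : ℝ)) 1 aestronglyMeasurable_const
      (Eventually.of_forall fun _ => by simp)
    simp only [mul_one] at key
    rw [totalMass_eq_integral_prod hft]
    refine key.congr fun k => ?_
    exact (totalMass_eq_integral_prod (hfn _ t ht)).symm
  -- (2) `∫∫ f^{φ k}(0) → ∫∫ f₀` by strong `L¹` convergence of the data
  have h2 : Tendsto (fun k => Literature.Analysis.FluidPDE.totalMass (fseq (φ k) 0)) atTop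
      (𝓝 (Literature.Analysis.FluidPDE.totalMass f₀)) := by
    have hL1 := hdata.tendsto_lintegral_sub.comp hφ.tendsto_atTop
    have key := tendsto_integral_of_L1 (fun z : E × E => f₀ z.1 z.2) hf0i.1
      (Eventually.of_forall fun k => hfn (φ k) 0 le_rfl) hL1
    rw [totalMass_eq_integral_prod hf0i]
    refine key.congr fun k => ?_
    exact (totalMass_eq_integral_prod (hfn _ 0 le_rfl)).symm
  -- (3) conservation of mass for the approximate solutions, and uniqueness of limits
  have h3 : (fun k => Literature.Analysis.FluidPDE.totalMass (fseq (φ k) t)) =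
      fun k => Literature.Analysis.FluidPDE.totalMass (fseq (φ k) 0) := funext fun k => hmass (φ k) t ht
  rw [h3] at h1
  exact tendsto_nhds_unique h1 h2

end Literature.MathematicalPhysics.KineticTheory
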